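import Mathlib
import HarnessLib

/-!
# Fermat cycles — `(10, 69)`: kernel record of LEMMA Q2 (the leading-exponent criterion of the FAMILY-P cube stage)

HONEST FRAMING: explicit algebraic cycles for specific Hodge classes on Fermat/Delsarte varieties;
residual open instances listed; no claim on general Hodge.

Cell `pub-hfermat`, track FIND-THE-CLASS, seat ftc-engine gen-13; companion of the cell files `ftc/certs/W69/QCLASS.md`
(ENGINE v11, THEOREMS QV / QB / QC) and `ftc/certs/W69/CSCROLL.md` (ENGINE v12).  In those classifications a FAMILY-P
surface `S ⊂ ℙ⁴` with factorial Cox ring `R` is one on which `σ · D₀' |_S = c · g³` for a unit `c` (LEMMA Q0); the machine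
decides the negation for whole parameter families by the LEADING-EXPONENT CRITERION (LEMMA Q2): for every monomial order,
the leading exponent of `c · g ^ n` is `n` times the leading exponent of `g`, so a polynomial `F` whose leading exponent has a
coordinate not divisible by `n` is not of the form `c · g ^ n` (`c ≠ 0`) — over any field, for any family member whose leading
coefficient does not vanish.  This file records exactly that criterion for the kernel, for an arbitrary monomial order on an
arbitrary polynomial ring over a field (Mathlib's `MonomialOrder.degree`).  Nothing here is a cycle, a class or a Hodge-theoretic
statement: `(10,69)` is OPEN.
-/

namespace Summit.HodgeConjecture.FermatCycles.CubeLeadingExponent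

open MvPolynomial

variable {σ : Type*} {k : Type*} [Field k] (m : MonomialOrder σ)

/-- The leading exponent (for the monomial order `m`) of `c • g ^ n` with `c ≠ 0` is `n` times the leading exponent of `g`. -/
theorem degree_smul_pow {c : k} (hc : c ≠ 0) (g : MvPolynomial σ k) (n : ℕ) :
    m.degree (c • g ^ n) = n • m.degree g := by
  rw [m.degree_smul_of_mem_nonZeroDivisors (mem_nonZeroDivisors_of_ne_zero hc), m.degree_pow]

/-- Hence every coordinate of the leading exponent of `c • g ^ n` (`c ≠ 0`) is divisible by `n`. -/
theorem dvd_degree_smul_pow {c : k} (hc : c ≠ 0) (g : MvPolynomial σ k) (n : ℕ) (i : σ) :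
    n ∣ m.degree (c • g ^ n) i := by
  rw [degree_smul_pow m hc g n, Finsupp.smul_apply, smul_eq_mul]
  exact Dvd.intro _ rfl

/-- LEMMA Q2 (leading-exponent criterion), as used by the cube stage: if some coordinate of the leading exponent of `F` is NOT
divisible by `n`, then `F` is not a non-zero constant times an `n`-th power. -/
theorem not_eq_smul_pow_of_not_dvd {F : MvPolynomial σ k} {n : ℕ} {i : σ} (h : ¬ n ∣ m.degree F i)
    {c : k} (hc : c ≠ 0) (g : MvPolynomial σ k) : F ≠ c • g ^ n := by
  intro hF
  exact h (hF ▸ dvd_degree_smul_pow m hc g n i)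

/-- The cube case (`n = 3`) in the multiplicative form `F = C c * g ^ 3` in which the cell files state it. -/
theorem not_eq_C_mul_cube_of_not_dvd {F : MvPolynomial σ k} {i : σ} (h : ¬ 3 ∣ m.degree F i)
    {c : k} (hc : c ≠ 0) (g : MvPolynomial σ k) : F ≠ C c * g ^ 3 := by
  rw [← smul_eq_C_mul]
  exact not_eq_smul_pow_of_not_dvd m h hc g

end Summit.HodgeConjecture.FermatCycles.CubeLeadingExponent
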